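import Mathlib
import HarnessLib
import HarnessLib.Audit
import Summits.CriticalPhenomena.PercolationContinuityZ3.Theorems.PercNearOneGluingNoHeavyLowerTailHexMSMatchCorners

/-!
# Conjecture (MATCH), two dead classes: Hall's condition for product-structured (Marica–Schönheim-tight) families (hp-7 gen 69)

Support file for crux `stmt-CriticalPhenomena-4575` (route `PercNearOneGluingNoHeavy`), hull-port seat `prim-hp-7` (generation 69);
`--supports stmt-CriticalPhenomena-4575`.  No `sorry`.  Memo: `run/shared/lean/prim/prim-hp-7/FROM-prim-hp-7-g69-MATCH-SYMMETRIC.md` §4.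

A TWISTED PRODUCT is a family `F = { a ∪ (I \ d₁) ∪ d₂ : d₁ ∈ D₁, d₂ ∈ D₂ }` with `D₁ ⊆ 𝒫 I`, `D₂ ⊆ 𝒫 J`, `a, I, J` pairwise disjoint and `D₁, D₂`
DIFFERENCE-CLOSED (`d, d' ∈ Dᵢ ⟹ d \ d' ∈ Dᵢ`).  Such families satisfy `#(F \\ F) = #F` (equality in Marica–Schönheim), and gen 69 verified
exhaustively on `2^[4]` (all 65 535 families; 717 tight) and on random families of `2^[5]` that EVERY family with `#(F \\ F) = #F` is a twisted product
(memo §4 (AH″); presumably the equality theorem of Aharoni–Holzman, J. LMS 48 (1993) — not used here).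

* `not_blocked_of_twistedProduct` — **a two-class dead family that is a twisted product has no blocked pair**: for `p, q ∈ F` dead with `x q = x p + 1`,
  neither `p \ q` nor `q \ p` is a member.  (For `p ↔ (d₁,d₂)`, `q ↔ (d₁',d₂')` the product contains `f₁ ↔ (d₁', d₂ ∩ d₂') ⊆ q`, disjoint from `γ = p \ q`,
  and `f₁ ∪ γ ↔ (d₁ ∩ d₁', d₂)`; by `…HexMSMatchCorners` (TightCase) a dead member labelled `x p` must meet `γ`, and one labelled `x q` disjoint from
  `γ` has `f₁ ∪ γ` not dead — but `f₁ ∪ γ ∈ F` is dead.)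
* `card_le_card_biUnion_candidates_of_twistedProduct` — hence **Hall's condition for `A = cl F`**: the candidates contain `cl(F \\ F)` (no blockers; same-label
  differences are never members, gen 67), which has `≥ 2 #F = #A` members by Δ-MS (gen 66).  With (AH″) this is the Δ-MS-TIGHT case of the two-class
  Conjecture V-b / (MATCH) (gen 69 memo; exact for n ≤ 6 by SAT, kit j235242).
-/

namespace Summit.CriticalPhenomena.PercolationContinuityZ3.Theorems

namespace GeneratedDonors

open Finset FinsetFamily

variable {α : Type*} [DecidableEq α]
variable {U : Finset α} {𝒟 : Finset (Finset α)} {x : Finset α → ZMod 6}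

section TwistedProduct

variable {a I : Finset α} {D₁ D₂ : Finset (Finset α)}

/-- The twisted product family `{a ∪ (I \ d₁) ∪ d₂}`. -/
theorem mem_twistedProduct {f : Finset α} :
    f ∈ (D₁ ×ˢ D₂).image (fun e => a ∪ (I \ e.1) ∪ e.2) ↔ ∃ d₁ ∈ D₁, ∃ d₂ ∈ D₂, f = a ∪ (I \ d₁) ∪ d₂ := by
  rw [mem_image]
  constructor
  · rintro ⟨⟨d₁, d₂⟩, he, rfl⟩
    rw [mem_product] at he
    exact ⟨d₁, he.1, d₂, he.2, rfl⟩
  · rintro ⟨d₁, hd₁, d₂, hd₂, rfl⟩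
    exact ⟨(d₁, d₂), mem_product.mpr ⟨hd₁, hd₂⟩, rfl⟩

/-- Difference-closed families are closed under intersection (`d ∩ d' = d \ (d \ d')`). -/
theorem inter_mem_of_diffClosed {D : Finset (Finset α)} (hcl : ∀ d ∈ D, ∀ d' ∈ D, d \ d' ∈ D) {d d' : Finset α}
    (hd : d ∈ D) (hd' : d' ∈ D) : d ∩ d' ∈ D := by
  have e : d \ (d \ d') = d ∩ d' := by rw [sdiff_sdiff_right_self, Finset.inf_eq_inter]
  rw [← e]; exact hcl _ hd _ (hcl _ hd _ hd')

/-- In a twisted product, `a ∪ (I \ d₁') ∪ (d₂ ∩ d₂') ⊆ a ∪ (I \ d₁') ∪ d₂'`. -/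
theorem twisted_aux_subset (d₁' d₂ d₂' : Finset α) :
    a ∪ (I \ d₁') ∪ (d₂ ∩ d₂') ⊆ a ∪ (I \ d₁') ∪ d₂' :=
  union_subset_union le_rfl inter_subset_right

/-- The key set identity: `(a ∪ (I \ d₁') ∪ (d₂ ∩ d₂')) ∪ (p \ q) = a ∪ (I \ (d₁ ∩ d₁')) ∪ d₂` for `p = a ∪ (I \ d₁) ∪ d₂`, `q = a ∪ (I \ d₁') ∪ d₂'`,
when `d₁, d₁' ⊆ I` and `d₂'` is disjoint from `a ∪ I`. -/
theorem twisted_aux_union {d₁ d₁' d₂ d₂' : Finset α} (hd₁ : d₁ ⊆ I) (hd₁' : d₁' ⊆ I) (hd₂' : Disjoint d₂' (a ∪ I)) :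
    (a ∪ (I \ d₁') ∪ (d₂ ∩ d₂')) ∪ ((a ∪ (I \ d₁) ∪ d₂) \ (a ∪ (I \ d₁') ∪ d₂')) = a ∪ (I \ (d₁ ∩ d₁')) ∪ d₂ := by
  ext i
  simp only [mem_union, mem_sdiff, mem_inter, not_or, not_and, not_not]
  have h1 := @hd₁ i; have h2 := @hd₁' i
  have h3 : i ∈ d₂' → i ∉ a ∧ i ∉ I := fun h => by
    have := disjoint_left.mp hd₂' h
    rw [mem_union, not_or] at this; exact this
  tauto

/-- **No blocked pair in a two-class dead twisted product.** -/
theorem not_blocked_of_twistedProduct (hU : ∀ b ∈ 𝒟, b ⊆ U) (hco : ∀ b ∈ 𝒟, U \ b ∈ 𝒟)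
    (hanti : ∀ b ∈ 𝒟, x (U \ b) = x b + 3)
    (hd₁I : ∀ d ∈ D₁, d ⊆ I) (hd₂ : ∀ d ∈ D₂, Disjoint d (a ∪ I))
    (hcl₁ : ∀ d ∈ D₁, ∀ d' ∈ D₁, d \ d' ∈ D₁) (hcl₂ : ∀ d ∈ D₂, ∀ d' ∈ D₂, d \ d' ∈ D₂)
    (hF : (D₁ ×ˢ D₂).image (fun e => a ∪ (I \ e.1) ∪ e.2) ⊆ dead U 𝒟 x) {ℓ : ZMod 6}
    (hlab : ∀ f ∈ (D₁ ×ˢ D₂).image (fun e => a ∪ (I \ e.1) ∪ e.2), x f = ℓ ∨ x f = ℓ + 1)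
    {p q : Finset α} (hp : p ∈ (D₁ ×ˢ D₂).image (fun e => a ∪ (I \ e.1) ∪ e.2))
    (hq : q ∈ (D₁ ×ˢ D₂).image (fun e => a ∪ (I \ e.1) ∪ e.2)) (hpq : x q = x p + 1) :
    p \ q ∉ 𝒟 ∧ q \ p ∉ 𝒟 := by
  set F := (D₁ ×ˢ D₂).image (fun e => a ∪ (I \ e.1) ∪ e.2) with hFdef
  obtain ⟨d₁, hd₁, d₂, hd₂m, rfl⟩ := mem_twistedProduct.mp hp
  obtain ⟨d₁', hd₁', d₂', hd₂'m, rfl⟩ := mem_twistedProduct.mp hq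
  have hpd : a ∪ (I \ d₁) ∪ d₂ ∈ dead U 𝒟 x := hF hp
  have hqd : a ∪ (I \ d₁') ∪ d₂' ∈ dead U 𝒟 x := hF hq
  -- labels: x p = ℓ and x q = ℓ + 1
  have keylab : ∀ s t m : ZMod 6, (s = m ∨ s = m + 1) → (t = m ∨ t = m + 1) → t = s + 1 → s = m ∧ t = m + 1 := by decide
  obtain ⟨hxp, hxq⟩ := keylab _ _ ℓ (hlab _ hp) (hlab _ hq) hpq
  -- meets are differences of differences
  have hm₂ : d₂ ∩ d₂' ∈ D₂ := inter_mem_of_diffClosed hcl₂ hd₂m hd₂'m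
  have hm₂' : d₂' ∩ d₂ ∈ D₂ := inter_mem_of_diffClosed hcl₂ hd₂'m hd₂m
  have hm₁ : d₁ ∩ d₁' ∈ D₁ := inter_mem_of_diffClosed hcl₁ hd₁ hd₁'
  constructor
  · -- first kind: γ = p \ q
    intro hγ
    set f₁ := a ∪ (I \ d₁') ∪ (d₂ ∩ d₂') with hf₁
    have hf₁F : f₁ ∈ F := mem_twistedProduct.mpr ⟨d₁', hd₁', d₂ ∩ d₂', hm₂, rfl⟩
    have hf₁q : f₁ ⊆ a ∪ (I \ d₁') ∪ d₂' := twisted_aux_subset d₁' d₂ d₂'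
    have hdis : f₁ ∩ ((a ∪ (I \ d₁) ∪ d₂) \ (a ∪ (I \ d₁') ∪ d₂')) = ∅ := by
      rw [← disjoint_iff_inter_eq_empty]
      exact disjoint_of_subset_left hf₁q disjoint_sdiff_self_right
    rcases hlab _ hf₁F with h | h
    · -- label of p: must meet γ
      have := inter_blocker_nonempty_of_dead hU hco hanti hpd hqd hpq hγ (hF hf₁F) (by rw [h, hxp])
      rw [hdis] at this
      exact not_nonempty_empty this
    · -- label of q: f₁ ∪ γ is not dead, but it is in F
      have hnot := union_blocker_not_dead_of_dead hU hco hanti hpd hqd hpq hγ (hF hf₁F) (by rw [h, hxq])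
      apply hnot
      rw [hf₁, twisted_aux_union (hd₁I _ hd₁) (hd₁I _ hd₁') (hd₂ _ hd₂'m)]
      exact hF (mem_twistedProduct.mpr ⟨d₁ ∩ d₁', hm₁, d₂, hd₂m, rfl⟩)
  · -- second kind: γ' = q \ p, symmetric with the roles of (d₁,d₂) and (d₁',d₂') exchanged
    intro hγ
    set f₁ := a ∪ (I \ d₁) ∪ (d₂' ∩ d₂) with hf₁
    have hf₁F : f₁ ∈ F := mem_twistedProduct.mpr ⟨d₁, hd₁, d₂' ∩ d₂, hm₂', rfl⟩
    have hf₁p : f₁ ⊆ a ∪ (I \ d₁) ∪ d₂ := twisted_aux_subset d₁ d₂' d₂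
    have hdis : f₁ ∩ ((a ∪ (I \ d₁') ∪ d₂') \ (a ∪ (I \ d₁) ∪ d₂)) = ∅ := by
      rw [← disjoint_iff_inter_eq_empty]
      exact disjoint_of_subset_left hf₁p disjoint_sdiff_self_right
    rcases hlab _ hf₁F with h | h
    · -- label of p: f₁ ∪ γ' is not dead, but it is in F
      have hnot := union_blocker_not_dead_of_dead' hU hco hanti hpd hqd hpq hγ (hF hf₁F) (by rw [h, hxp])
      apply hnot
      rw [hf₁, twisted_aux_union (hd₁I _ hd₁') (hd₁I _ hd₁) (hd₂ _ hd₂m), inter_comm]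
      exact hF (mem_twistedProduct.mpr ⟨d₁ ∩ d₁', hm₁, d₂', hd₂'m, rfl⟩)
    · -- label of q: must meet γ'
      have := inter_blocker_nonempty_of_dead' hU hco hanti hpd hqd hpq hγ (hF hf₁F) (by rw [h, hxq])
      rw [hdis] at this
      exact not_nonempty_empty this

/-- Differences of two dead members with ADJACENT labels are candidates when they are not members. -/
theorem sdiff_mem_candidates_of_adjacent_of_notMem (hU : ∀ b ∈ 𝒟, b ⊆ U) (hco : ∀ b ∈ 𝒟, U \ b ∈ 𝒟)
    (hanti : ∀ b ∈ 𝒟, x (U \ b) = x b + 3) {p q : Finset α} (hp : p ∈ dead U 𝒟 x) (hq : q ∈ dead U 𝒟 x)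
    (hpq : x q = x p + 1) (h1 : p \ q ∉ 𝒟) (h2 : q \ p ∉ 𝒟) :
    p \ q ∈ candidates 𝒟 x p ∧ U \ (q \ p) ∈ candidates 𝒟 x p ∧ q \ p ∈ candidates 𝒟 x q ∧ U \ (p \ q) ∈ candidates 𝒟 x q := by
  have hpD : p ∈ 𝒟 := (mem_filter.mp hp).1
  have hqD : q ∈ 𝒟 := (mem_filter.mp hq).1
  have hsd : ∀ {c c' : Finset α}, c ∈ 𝒟 → c' ∈ 𝒟 → c \ c' = c ∩ (U \ c') := by
    intro c c' hc hc'
    have e := sdiff_univ_compl_eq_inter (U := U) (f := U \ c') (hU c hc)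
    rw [Finset.sdiff_sdiff_eq_self (hU c' hc')] at e
    exact e
  have hfar₁ : ¬ Close (x p) (x (U \ q)) := by
    rw [hanti q hqD, hpq]; exact not_close_add_one_add_three (x p)
  have hfar₂ : ¬ Close (x q) (x (U \ p)) := by
    rw [hanti p hpD, hpq]; have key : ∀ s : ZMod 6, ¬ Close (s + 1) (s + 3) := by decide
    exact key _
  have hc1 : U \ (q \ p) ∉ 𝒟 := fun h => h2 (by
    have e := hco _ h; rwa [Finset.sdiff_sdiff_eq_self (sdiff_subset.trans (hU q hqD))] at e)
  have hc2 : U \ (p \ q) ∉ 𝒟 := fun h => h1 (by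
    have e := hco _ h; rwa [Finset.sdiff_sdiff_eq_self (sdiff_subset.trans (hU p hpD))] at e)
  unfold candidates
  refine ⟨?_, ?_, ?_, ?_⟩
  · rw [mem_sdiff]; exact ⟨mem_farProducts.mpr ⟨U \ q, hco q hqD, hfar₁, Or.inl (hsd hpD hqD)⟩, h1⟩
  · rw [mem_sdiff]
    refine ⟨mem_farProducts.mpr ⟨U \ q, hco q hqD, hfar₁, Or.inr ?_⟩, hc1⟩
    rw [union_comm, compl_union_eq_compl_sdiff_inter q (hU p hpD), ← hsd hqD hpD]
  · rw [mem_sdiff]; exact ⟨mem_farProducts.mpr ⟨U \ p, hco p hpD, hfar₂, Or.inl (hsd hqD hpD)⟩, h2⟩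
  · rw [mem_sdiff]
    refine ⟨mem_farProducts.mpr ⟨U \ p, hco p hpD, hfar₂, Or.inr ?_⟩, hc2⟩
    rw [union_comm, compl_union_eq_compl_sdiff_inter p (hU q hqD), ← hsd hpD hqD]

/-- **Hall's condition for a two-class dead twisted product.**  If `F ⊆ dead` is a twisted product with labels in `{ℓ, ℓ+1}`, then the
complement-closed dead family `A = F ∪ co F` has at least `#A` candidates (in fact `cl(F \\ F)` consists of candidates). -/
theorem card_le_card_biUnion_candidates_of_twistedProduct (hU : ∀ b ∈ 𝒟, b ⊆ U) (hco : ∀ b ∈ 𝒟, U \ b ∈ 𝒟)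
    (hanti : ∀ b ∈ 𝒟, x (U \ b) = x b + 3)
    (hd₁I : ∀ d ∈ D₁, d ⊆ I) (hd₂ : ∀ d ∈ D₂, Disjoint d (a ∪ I))
    (hcl₁ : ∀ d ∈ D₁, ∀ d' ∈ D₁, d \ d' ∈ D₁) (hcl₂ : ∀ d ∈ D₂, ∀ d' ∈ D₂, d \ d' ∈ D₂)
    {F : Finset (Finset α)} (hFdef : F = (D₁ ×ˢ D₂).image (fun e => a ∪ (I \ e.1) ∪ e.2))
    (hF : F ⊆ dead U 𝒟 x) {ℓ : ZMod 6} (hlab : ∀ f ∈ F, x f = ℓ ∨ x f = ℓ + 1) :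
    #(F ∪ F.image fun f => U \ f) ≤ #((F ∪ F.image fun f => U \ f).biUnion (candidates 𝒟 x)) := by
  subst hFdef
  set F := (D₁ ×ˢ D₂).image (fun e => a ∪ (I \ e.1) ∪ e.2) with hFdef
  have hFD : ∀ f ∈ F, f ∈ 𝒟 := fun f hf => (mem_filter.mp (hF hf)).1
  have hFU : ∀ f ∈ F, f ⊆ U := fun f hf => hU f (hFD f hf)
  -- F is complement-free (labels ℓ, ℓ+1 vs ℓ+3, ℓ+4)
  have keylab : ∀ s m : ZMod 6, (s = m ∨ s = m + 1) → ¬ (s + 3 = m ∨ s + 3 = m + 1) := by decide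
  have hfree : ∀ f ∈ F, U \ f ∉ F := by
    intro f hf hcf
    have h1 := hlab _ hcf
    rw [hanti f (hFD f hf)] at h1
    exact keylab _ _ (hlab f hf) h1
  -- every element of cl(F \\ F) is a candidate of a member of F
  have hsub : (F \\ F) ∪ (F \\ F).image (fun z => U \ z) ⊆ (F ∪ F.image fun f => U \ f).biUnion (candidates 𝒟 x) := by
    have pair : ∀ {f f' : Finset α}, f ∈ F → f' ∈ F →
        f \ f' ∈ candidates 𝒟 x f ∧ U \ (f' \ f) ∈ candidates 𝒟 x f := by
      intro f f' hf hf'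
      rcases hlab f hf with h | h <;> rcases hlab f' hf' with h' | h'
      · exact sdiff_mem_candidates_of_label_eq hU hco hanti (hF hf) (hF hf') (by rw [h, h'])
      · -- x f' = x f + 1
        have hpq : x f' = x f + 1 := by rw [h, h']
        obtain ⟨n1, n2⟩ := not_blocked_of_twistedProduct hU hco hanti hd₁I hd₂ hcl₁ hcl₂ hF hlab hf hf' hpq
        have c := sdiff_mem_candidates_of_adjacent_of_notMem hU hco hanti (hF hf) (hF hf') hpq n1 n2
        exact ⟨c.1, c.2.1⟩
      · -- x f = x f' + 1
        have hpq : x f = x f' + 1 := by rw [h, h']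
        obtain ⟨n1, n2⟩ := not_blocked_of_twistedProduct hU hco hanti hd₁I hd₂ hcl₁ hcl₂ hF hlab hf' hf hpq
        have c := sdiff_mem_candidates_of_adjacent_of_notMem hU hco hanti (hF hf') (hF hf) hpq n1 n2
        exact ⟨c.2.2.1, c.2.2.2⟩
      · exact sdiff_mem_candidates_of_label_eq hU hco hanti (hF hf) (hF hf') (by rw [h, h'])
    intro p hp
    rw [mem_union, mem_image] at hp
    rcases hp with hp | ⟨q, hq, rfl⟩
    · rw [Finset.mem_diffs] at hp
      obtain ⟨f, hf, f', hf', rfl⟩ := hp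
      exact mem_biUnion.mpr ⟨f, mem_union_left _ hf, (pair hf hf').1⟩
    · rw [Finset.mem_diffs] at hq
      obtain ⟨f', hf', f, hf, rfl⟩ := hq
      exact mem_biUnion.mpr ⟨f, mem_union_left _ hf, (pair hf hf').2⟩
  have hinj : Set.InjOn (fun f : Finset α => U \ f) ↑F := by
    intro p hp q hq hpq
    have e := congrArg (fun t => U \ t) hpq
    simp only [Finset.sdiff_sdiff_eq_self (hFU p (mem_coe.mp hp)), Finset.sdiff_sdiff_eq_self (hFU q (mem_coe.mp hq))] at e
    exact e
  have hdisj : Disjoint F (F.image fun f => U \ f) := by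
    rw [disjoint_left]
    intro s hs hs'
    obtain ⟨f, hf, rfl⟩ := mem_image.mp hs'
    exact hfree f hf hs
  have hcard : #(F ∪ F.image fun f => U \ f) = 2 * #F := by
    rw [card_union_of_disjoint hdisj, card_image_of_injOn hinj]; ring
  rw [hcard]
  exact (two_mul_card_le_card_cl_diffs U F hFU hfree).trans (card_le_card hsub)

end TwistedProduct

end GeneratedDonors

end Summit.CriticalPhenomena.PercolationContinuityZ3.Theorems
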